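import Summits.QuantumFields.YangMills.Theorems.BalabanUVNodesN12AtRecord12LiveSelector
import Literature.MathematicalPhysics.QuantumFieldTheory.Balaban1983to89.B15Claim189PrintedConditions
import Literature.MathematicalPhysics.QuantumFieldTheory.Balaban1983to89.B15Claim189N0OfRecord

/-!
# BalabanUVNodes ∕ N12 AT THE TERM-PINNED LAYER `λ⁵ := (λ.pinRPrime θ₉).pinD189T θ₉ σ s N₀ p₁` — the [IV] leaf, N12's pointed row and the `NodesAtSomeRecord12` body WITH THE
# (1.89) DISPLAY REPLACED BY ITS PRINTED INPUTS ((1.80) + four ℍ-leaves + located geometry + print's two p. 200 conditions + the run's window)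
# (sequel of `BalabanUVNodesN12AtRecord12Pointed` ∕ `…LiveSelector`; Track A, DAG node N12 = [B15, Balaban1989LargeFieldI] CMP 122 (1989) 175; cluster K1′ `StabilityBAtRecordR12e` =
# stmt-QuantumFields-19903 (rev 15); seat `pub-ymgap-dag-n12-e` g4 (R134 s3 «the (1.80)∕(1.89) + R′ (1.99)–(1.100) p.201 chain»), 2026-08-27; count-neutral, NOT a discharge)
HONEST FRAMING.  Count-neutral kernel BOOKKEEPING BY NAME over dag-n12-d's modules 1–2 and this seat's Literature module 11 (`B15Claim189PrintedConditions`); nothing of Bałaban's asserted;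
N12 NOT discharged (5∕27 unchanged); nothing continuum ∕ ℝ⁴ ∕ OS ∕ mass gap ∕ Clay.
WHY THIS FILE.  dag-n12-d's N12 row at the fully-lettered layer `λ⁴` (`…Pointed` §3–§5, `…LiveSelector` §3–§5) carries TWO [IV] displays per run: (1.80) (`h180`) and (1.89) (`h189 :
Claim189 (new189 D) (chiPP D)`).  Module 11 pins the (1.89) situation's top level and regions `Ω_j` to the run's TERM of the (2.18) index of record (`s P : SeqOfRecord … (kSel P + 1)`, def-R
ANSWER-1: print-§1's `k` IS `kSel P + 1`) and proves the (1.89) display at the term-pinned letters FROM the (1.80) display, the four ℍ-leaves (1.90)–(1.91) ∕ (1.93)–(1.95) ∕ p. 199's two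
(1.91)-type bounds, the located geometry (`Z″_k ∩ Ω_m ⊆ Ω_{m+1}`, the shell bound, the (1.88) cube cover), the residual numerics `β, L₀`, signs, PRINT'S TWO p. 200 CONDITIONS on `N₀`
and `M`, and the flow inputs (from the run's window, or displayed).  Here that is knitted into dag-n12-d's row: at `λ⁵ := (λ.pinRPrime θ₉).pinD189T θ₉ σ s N₀ p₁` (= `λ⁴` at the
term-pinned, numbers-pinned situations, `rfl`) the [IV] leaf, hence N12's pointed row and the closer's body, need NO separate (1.89) display.
* §1 (Stage-9 generic) `pinAllT_eq` (`λ⁵` IS `λ⁴` at `σ″ := P ↦ ((σ P).pinTerm (s P)).pinNumerics θ.τ9 N₀`, `rfl`), `pinAllT_levels` (`k = kSel P + 1`); **`b15Leaf_WOfRecord₁₀_pinAllT_of_deg_massSel`**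
  (the leaf at `WOfRecord₁₀ θ λ⁵ P` from `Provisos₁₀`, `hdeg`, `hmassSel`, `hfib`, Prop. 1, (1.80) and the (1.89) residue — window form: the flow inputs read off the run's window by module 5).
* §2 (Stage-12) N12's pointed row `b15Leaf_res_W_pinW_WOfRecord₁₂_pinAllT_of_deg_massSel` and the `NodesAtSomeRecord12` body `nodesAtSomeRecord₁₂_of_pointed_pinW_WOfRecord₁₂_pinAllT`
  (module 1 §5 at `W₀ := WOfRecord₁₂ θ λ⁵`, N12 := the §1 leaf run by run).
* (v1.1) §1 **`b15Leaf_WOfRecord₁₀_pinAllT_of_deg_massSel_of_flow`** — the same leaf in WINDOW-FREE form (flow inputs `hε0 ∕ hε1 ∕ hflow` displayed at the thresholds of record;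
  module 11 v1.1's `h189_pinD189T_of_h180_of_flow`); §3 **`not_smallnessFor_theta12Live`** — CENSUS (typing strength, count-neutral): on the K0′ witness line `θ₀ˡⁱᵛᵉ` (`γ = 1/2`, K0a)
  [III] (2.7)'s `SmallnessFor θ₀ˡⁱᵛᵉ.γ …` is FALSE (`4p₀ + 2 ≤ log γ⁻² ≤ log 4 < 2`), so the window forms do not instantiate there and the flow inputs stay displayed (window-free forms);
  the witness-line ∕ live-re-pin rows themselves are dag-n12-d's lane (`…N12AtRecord12TermPinned`, g5).
* (v1.2) §4 `WOfRecord₁₀_pinAllN` (`rfl`), **`b15Leaf_WOfRecord₁₀_pinAllN_of_deg_massSel`** ∕ **`…_of_flow`** — the leaf at `λᴺ := (λ.pinRPrime θ₉).pinD189N θ₉ σ s p₁` (module 12: `N₀ :=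
  N0OfRecord θ P (kSel P + 1)` per run): NO `N₀` parameter, print's FIRST p. 200 condition DISCHARGED (module 12's `printCond1_N0OfRecord_of_threshold`) in exchange for `r ≥ 1` ∕
  `1 < (log g⁻²)^r`, `β ≥ 0` along the history and ONE threshold on the top coupling (*"or γ sufficiently small"*).
WHAT N12 THEN COSTS per run at `λ⁵` (typing strength, NOT a second gap): `hdeg`, positive mass (`hmassSel ∧ hfib`, or of the live terms on a live re-pin), Prop. 1 at `λ.LF P` (dag-n12-c),
(1.80) at `U₀ = U_{k,Z}(V_Λ)` of record, the four ℍ-leaves ([B11]-at-objects, N07), the located geometry of the residual regions `Z″_j, Λ, Ω″` and cube families, `β ∈ [0, 1/4]`, `2 ≤ L₀`,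
`L₀² ≤ L`, signs of `O(1)B₃B₅, δ, dist`, print's two p. 200 conditions, `2 ≤ N₀ ≤ N`, `N₀ ≤ kSel P + 1`, and the flow inputs (window or displayed).  One finite four-torus programme at fixed
`ε`; 0 `sorry`, 0 `def`, standard axioms.  Filed `--supports` K1′ (19903).
Sources: [Balaban1989LargeFieldI] (0.2)–(0.6) p.176, p.177, (1.2) p.178, Prop. 1 p.194, (1.80) p.195, (1.89) p.198, pp.199–200; [Balaban1988Convergent] (2.1) p.254, (2.7)–(2.8) pp.255–256,
(2.18) p.257; [Balaban1989LargeFieldII] Thm 1 + (0.1) pp.355–356.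
-/

noncomputable section

open MeasureTheory
open scoped Matrix.Norms.L2Operator

namespace Summit.QuantumFields.YangMills.BalabanUVNodes.N12AtRecord12TermPin
open Literature.MathematicalPhysics.QuantumFieldTheory.Balaban1983to89
open Literature.MathematicalPhysics.QuantumFieldTheory.Balaban1983to89.T4Continuum (T4Family)
open Literature.MathematicalPhysics.QuantumFieldTheory.Balaban1983to89.DagBinding (WorldP leavesP PrintedCarriersR PrintedCarriers15 B15Leaf B8LeafR B9LeafX B11Leaf Nodes)
open Literature.MathematicalPhysics.QuantumFieldTheory.Balaban1983to89.Node00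
open B15Claim189Assembly (Setting189 new189 chiPP dom half)
open B15Claim189PinAtRecord (D189OfRecord)
open B15Claim189PrintedConditions (omegaOfChain sitOfTerm h189_pinD189T_of_h180 h189_pinD189T_of_h180_of_flow not_smallnessFor_of_half_le)
open B15Claim189N0OfRecord (N0OfRecord h189_pinD189N_of_h180 h189_pinD189N_of_h180_of_flow)
open B15DeterminingSets (MSField)
open B15 (Prop1Printed Ineq180)
open B15.BasicStep (Claim189)
open B15.PrelimIntegrations (Ineq191 Ineq195)
open B15Chi124DetSets (E124)
open B14DomainGeom (Pt)
open B8Eq17ClassAkV1 (plaqsOf)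
open GaugeGroup (dist1)
open GaugeField (plaqHol)
open FlowStep (prefixOf BetaUpperH)
open B14FlowStep (SmallnessFor)
open Summit.QuantumFields.YangMills.BalabanUVNodes.N12AtRecord12Pointed (b15Leaf_WOfRecord₁₀_pinAllχ₀_of_deg_massSel nodesAtSomeRecord₁₂_of_pointed_pinW)

variable {N : ℕ} [NeZero N] {F : T4Family}

/-! ## §1 STAGE-9 GENERIC — the term-pinned fully-lettered layer `λ⁵` and the [IV] leaf at it with (1.89) FROM (1.80) -/

section Layer
variable {θ : Stage9Params F N} {lam : ResidW F N} (σ : ∀ P : B12.RunParams, Sit189 F N P.K)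
  (s : ∀ P : B12.RunParams, SeqOfRecord F θ.ν θ.τ9.M (gOfRecord₁₀ F N θ P) P.K (lam.kSel P + 1)) (N₀ p₁ : ℕ)

/-- `λ⁵` IS dag-n12-d's `λ⁴` at the term-pinned, numbers-pinned situations `σ″ := P ↦ ((σ P).pinTerm (s P)).pinNumerics θ.τ9 N₀` (`rfl`; the (1.100) pin keeps `kSel`, so the term
selector `s` serves both sides). [cite: Balaban1989LargeFieldI, (1.89) p.198, (1.100) p.201 (bookkeeping)] -/
theorem pinAllT_eq : (lam.pinRPrime θ).pinD189T θ σ s N₀ p₁ = (lam.pinRPrime θ).pinD189χ₀ θ (fun P => ((σ P).pinTerm (s P)).pinNumerics θ.τ9 N₀) p₁ := rfl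

/-- The levels of the (1.89) letters at `λ⁵`: `k = kSel P + 1` (def-R ANSWER-1), `h = kSel P + 1 − N`, `k₀ = kSel P + 1 − N₀`; the step selector and the Proposition-1 carrier are `λ`'s (`rfl`).
[cite: Balaban1989LargeFieldI, p.177 («kth density, instead of k+1st»), p.178, p.181, (0.2) p.176 (bookkeeping)] -/
theorem pinAllT_levels (P : B12.RunParams) : (((lam.pinRPrime θ).pinD189T θ σ s N₀ p₁).D189 P).k = lam.kSel P + 1 ∧
    (((lam.pinRPrime θ).pinD189T θ σ s N₀ p₁).D189 P).h = lam.kSel P + 1 - θ.τ9.Nmem ∧ (((lam.pinRPrime θ).pinD189T θ σ s N₀ p₁).D189 P).k₀ = lam.kSel P + 1 - N₀ ∧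
    ((lam.pinRPrime θ).pinD189T θ σ s N₀ p₁).kSel = lam.kSel ∧ ((lam.pinRPrime θ).pinD189T θ σ s N₀ p₁).LF = lam.LF := ⟨rfl, rfl, rfl, rfl, rfl⟩

/-- **THE [IV] LEAF AT `WOfRecord₁₀ θ λ⁵ P` WITH NO SEPARATE (1.89) DISPLAY** — dag-n12-d's `b15Leaf_WOfRecord₁₀_pinAllχ₀_of_deg_massSel` at `σ″`, its `h189` slot SUPPLIED by module 11's
`h189_pinD189T_of_h180` from the SAME `h180` slot and the (1.89) residue (window form).  For the letters `D = λ⁵.D189 P` (defining equation `hD`; instantiate with `rfl`).  Displayed: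
`Provisos₁₀`, `hdeg`, `hmassSel`, `hfib`, Prop. 1 at `λ.LF P`, (1.80) (`h180`); levels `2 ≤ N₀ ≤ N`, `N₀ ≤ kSel P + 1`; `β ∈ [0, 1/4]`, `2 ≤ L₀`, `L₀² ≤ L`, `0 ≤ O(1)B₃B₅`, `0 ≤ δ`, `dist ≥ 0`;
print's two p. 200 conditions; `0 ≤ A₀`, `SmallnessFor`, `β₀ ≤ ½`, `γA₀(log γ⁻²)^{p₀} ≤ 1/10`, the run's window up to `kSel P + 1`, the BOX β bound; `Z″_k ∩ Ω_m ⊆ Ω_{m+1}`, the shell bound, the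
(1.88) cover; the four ℍ-leaves. [cite: Balaban1989LargeFieldI, (0.2)–(0.6) p.176, p.176 ll.14–16, Prop. 1 (1.78) p.194, (1.80) p.195, (1.89) p.198, pp.199–200; Balaban1988Convergent, (2.1) p.254, (2.8) p.256] -/
theorem b15Leaf_WOfRecord₁₀_pinAllT_of_deg_massSel (hP : θ.Provisos₁₀) {P : B12.RunParams}
    {D : Setting189 (F.P P.K) (SU N) (MSField (F.P P.K) (SU N) × ((j : ℕ) → VecField (F.P P.K) j (EuclideanSpace ℝ (Fin (N ^ 2 - 1))))) (Pt (F.P P.K).d)}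
    (hD : D = ((lam.pinRPrime θ).pinD189T θ σ s N₀ p₁).D189 P)
    (hdeg : P.K ≤ lam.kSel P →
      (repDataOfSel (repTOfRecord9 F N θ.ν θ.τ9 (EOfRecord₁₀ F N θ) (wOfRecord₉ F N θ) θ.ppSel P (gOfRecord₁₀ F N θ P) (lam.kSel P))
        (θ.ppSel P (gOfRecord₁₀ F N θ P) (lam.kSel P + 1)) (fibOfSeq F θ.ν θ.τ9 P (gOfRecord₁₀ F N θ P) (lam.kSel P + 1))).ProvisosSupp)
    (hmassSel : ∀ t, 0 < ∫ V, rterm (repTOfRecord9 F N θ.ν θ.τ9 (EOfRecord₁₀ F N θ) (wOfRecord₉ F N θ) θ.ppSel P (gOfRecord₁₀ F N θ P) (lam.kSel P))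
      (θ.ppSel P (gOfRecord₁₀ F N θ P) (lam.kSel P + 1) t) V ∂(fieldMeasure (F.P P.K) (lam.kSel P + 1) (SU N)))
    (hfib : ∀ t, ∃ t', θ.ppSel P (gOfRecord₁₀ F N θ P) (lam.kSel P + 1) t' = θ.ppSel P (gOfRecord₁₀ F N θ P) (lam.kSel P + 1) t ∧
      0 < ∫ V, rterm (repTOfRecord9 F N θ.ν θ.τ9 (EOfRecord₁₀ F N θ) (wOfRecord₉ F N θ) θ.ppSel P (gOfRecord₁₀ F N θ P) (lam.kSel P)) t' V
        ∂(fieldMeasure (F.P P.K) (lam.kSel P + 1) (SU N)))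
    (hP1 : Prop1Printed (lam.LF P))
    (h180 : ∀ U, new189 D U → ∀ i, D.h ≤ i → i ≤ D.k → ∀ q ∈ plaqsOf (dom D i), Ineq180 (D.dev0 U q) (D.ε D.k) D.η D.B₃ D.B₅ D.M D.δ (D.dist q) D.O1)
    -- the (1.89) residue
    (hN2 : 2 ≤ N₀) (hNN : N₀ ≤ θ.τ9.Nmem) (hNk : N₀ ≤ lam.kSel P + 1)
    (hβ0 : 0 ≤ (σ P).β) (hβ : (σ P).β ≤ 1 / 4) (hL₀ : 2 ≤ (σ P).L₀) (hL₀L : (σ P).L₀ ^ 2 ≤ ((F.P P.K).L : ℝ))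
    (hB : 0 ≤ (σ P).O1 * (σ P).B₃ * (σ P).B₅) (hδ : 0 ≤ (σ P).δ) (hdist : ∀ p, 0 ≤ (σ P).dist p)
    (hN₀ : (2 + (121 / 120) ^ 2 * ((σ P).O1 * (σ P).B₃ * (σ P).B₅ * (θ.τ9.M : ℝ) ^ 5)) * (((σ P).L₀ ^ 2) ^ (N₀ - 1))⁻¹ ≤ 1 / 4)
    (hMl : (121 / 120) ^ 2 * ((σ P).O1 * (σ P).B₃ * (σ P).B₅ * (θ.τ9.M : ℝ) ^ 5) * Real.exp (-(4 * (σ P).δ * (θ.τ9.M : ℝ))) ≤ 1 / 12)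
    (hA₀ : 0 ≤ θ.ν.A₀) {β' β₀ : ℝ} {L : ℕ} (S : SmallnessFor θ.γ β' β₀ L θ.ν.p₀) (hβ₀ : β₀ ≤ 1 / 2) (hε10 : θ.γ * p0Profile θ.ν.A₀ θ.ν.p₀ θ.γ ≤ 1 / 10)
    (hI : Step.InInterval θ.γ (lam.kSel P + 1) (gOfRecord₁₀ F N θ P)) (hup : BetaUpperH β' θ.γ (betaOfRecord₁₀ F N θ))
    (hZk : ∀ m, lam.kSel P + 1 - N₀ < m → m < lam.kSel P + 1 → (σ P).Zpp (lam.kSel P + 1) ∩ omegaOfChain (s P) m ⊆ omegaOfChain (s P) (m + 1))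
    (hgeom : ∀ m, D.k₀ < m → m < D.k → ∀ p ∈ plaqsOf (D.Ω m \ D.Ω (m + 1)), 4 * ((m : ℝ) - D.k₀) * D.M ≤ D.dist p)
    (hbox : ∀ p ∈ plaqsOf (half D), D.boxOf p ∈ D.halfcubes ∧ p ∈ D.plaqT (D.boxOf p))
    (L91h : ∀ U, new189 D U → ∀ p ∈ plaqsOf (half D),
      Ineq191 (dist1 (plaqHol (D.Upp U) p)) (D.devV'' U p) D.α ((D.L ^ D.h)⁻¹) (D.ε D.h) (E124 D.ε D.L D.η D.k D.h))
    (L95 : ∀ U, new189 D U → ∀ p ∈ plaqsOf (half D),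
      Ineq195 (D.devV'' U p) (dist1 (plaqHol (D.Uhalf U (D.boxOf p)) p)) D.α ((D.L ^ D.h)⁻¹) (D.ε D.h) (E124 D.ε D.L D.η D.k D.h))
    (L91 : ∀ U, new189 D U → ∀ j, D.h ≤ j → j ≤ D.k → ∀ p ∈ plaqsOf (dom D j),
      Ineq191 (dist1 (plaqHol (D.Upp U) p)) (D.dev97 U p) D.α ((D.L ^ j)⁻¹) (D.ε j) (E124 D.ε D.L D.η D.k j))
    (L97 : ∀ U, new189 D U → ∀ j, D.h ≤ j → j ≤ D.k → ∀ p ∈ plaqsOf (dom D j),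
      Ineq191 (D.dev97 U p) (D.dev0 U p) D.α ((D.L ^ j)⁻¹) (D.ε j) (E124 D.ε D.L D.η D.k j)) :
    B15Leaf (WOfRecord₁₀ F N θ ((lam.pinRPrime θ).pinD189T θ σ s N₀ p₁) P) := by
  subst hD
  exact b15Leaf_WOfRecord₁₀_pinAllχ₀_of_deg_massSel (fun P => ((σ P).pinTerm (s P)).pinNumerics θ.τ9 N₀) p₁ hP hdeg hmassSel hfib hP1 h180
    (h189_pinD189T_of_h180 N₀ p₁ (lam.pinRPrime θ) σ s P hN2 hNN hNk hβ0 hβ hL₀ hL₀L hB hδ hdist hN₀ hMl hA₀ S hβ₀ hε10 hI hup hZk hgeom hbox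
      L91h L95 L91 L97 h180)

/-- **THE SAME LEAF, WINDOW-FREE FORM** — the flow inputs `0 ≤ ε_i ≤ 1/10` on `[kSel P + 1 − N, kSel P + 1]` and [III] (2.8) `ε_{k} ≤ (1+β₀)(k−j)^{1/2}ε_j` DISPLAYED at the thresholds of
record instead of read off a window (for witness lines whose `γ` is not (2.7)-small, §3). [cite: Balaban1989LargeFieldI, (0.2)–(0.6) p.176, Prop. 1 (1.78) p.194, (1.80) p.195, (1.89) p.198, pp.199–200; Balaban1988Convergent, (2.8) p.256] -/
theorem b15Leaf_WOfRecord₁₀_pinAllT_of_deg_massSel_of_flow (hP : θ.Provisos₁₀) {P : B12.RunParams}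
    {D : Setting189 (F.P P.K) (SU N) (MSField (F.P P.K) (SU N) × ((j : ℕ) → VecField (F.P P.K) j (EuclideanSpace ℝ (Fin (N ^ 2 - 1))))) (Pt (F.P P.K).d)}
    (hD : D = ((lam.pinRPrime θ).pinD189T θ σ s N₀ p₁).D189 P)
    (hdeg : P.K ≤ lam.kSel P →
      (repDataOfSel (repTOfRecord9 F N θ.ν θ.τ9 (EOfRecord₁₀ F N θ) (wOfRecord₉ F N θ) θ.ppSel P (gOfRecord₁₀ F N θ P) (lam.kSel P))
        (θ.ppSel P (gOfRecord₁₀ F N θ P) (lam.kSel P + 1)) (fibOfSeq F θ.ν θ.τ9 P (gOfRecord₁₀ F N θ P) (lam.kSel P + 1))).ProvisosSupp)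
    (hmassSel : ∀ t, 0 < ∫ V, rterm (repTOfRecord9 F N θ.ν θ.τ9 (EOfRecord₁₀ F N θ) (wOfRecord₉ F N θ) θ.ppSel P (gOfRecord₁₀ F N θ P) (lam.kSel P))
      (θ.ppSel P (gOfRecord₁₀ F N θ P) (lam.kSel P + 1) t) V ∂(fieldMeasure (F.P P.K) (lam.kSel P + 1) (SU N)))
    (hfib : ∀ t, ∃ t', θ.ppSel P (gOfRecord₁₀ F N θ P) (lam.kSel P + 1) t' = θ.ppSel P (gOfRecord₁₀ F N θ P) (lam.kSel P + 1) t ∧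
      0 < ∫ V, rterm (repTOfRecord9 F N θ.ν θ.τ9 (EOfRecord₁₀ F N θ) (wOfRecord₉ F N θ) θ.ppSel P (gOfRecord₁₀ F N θ P) (lam.kSel P)) t' V
        ∂(fieldMeasure (F.P P.K) (lam.kSel P + 1) (SU N)))
    (hP1 : Prop1Printed (lam.LF P))
    (h180 : ∀ U, new189 D U → ∀ i, D.h ≤ i → i ≤ D.k → ∀ q ∈ plaqsOf (dom D i), Ineq180 (D.dev0 U q) (D.ε D.k) D.η D.B₃ D.B₅ D.M D.δ (D.dist q) D.O1)
    (hN2 : 2 ≤ N₀) (hNN : N₀ ≤ θ.τ9.Nmem) (hNk : N₀ ≤ lam.kSel P + 1)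
    (hβ0 : 0 ≤ (σ P).β) (hβ : (σ P).β ≤ 1 / 4) (hL₀ : 2 ≤ (σ P).L₀) (hL₀L : (σ P).L₀ ^ 2 ≤ ((F.P P.K).L : ℝ))
    (hB : 0 ≤ (σ P).O1 * (σ P).B₃ * (σ P).B₅) (hδ : 0 ≤ (σ P).δ) (hdist : ∀ p, 0 ≤ (σ P).dist p)
    (hN₀ : (2 + (121 / 120) ^ 2 * ((σ P).O1 * (σ P).B₃ * (σ P).B₅ * (θ.τ9.M : ℝ) ^ 5)) * (((σ P).L₀ ^ 2) ^ (N₀ - 1))⁻¹ ≤ 1 / 4)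
    (hMl : (121 / 120) ^ 2 * ((σ P).O1 * (σ P).B₃ * (σ P).B₅ * (θ.τ9.M : ℝ) ^ 5) * Real.exp (-(4 * (σ P).δ * (θ.τ9.M : ℝ))) ≤ 1 / 12)
    (hε0 : ∀ i, lam.kSel P + 1 - θ.τ9.Nmem ≤ i → i ≤ lam.kSel P + 1 → 0 ≤ epsOfRecord θ.ν (gOfRecord₁₀ F N θ P) i)
    (hε1 : ∀ i, lam.kSel P + 1 - θ.τ9.Nmem ≤ i → i ≤ lam.kSel P + 1 → epsOfRecord θ.ν (gOfRecord₁₀ F N θ P) i ≤ 1 / 10)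
    {β₀ : ℝ} (hβ₀0 : 0 ≤ β₀) (hβ₀ : β₀ ≤ 1 / 2)
    (hflow : ∀ j, lam.kSel P + 1 - θ.τ9.Nmem ≤ j → j < lam.kSel P + 1 →
      epsOfRecord θ.ν (gOfRecord₁₀ F N θ P) (lam.kSel P + 1) ≤ (1 + β₀) * Real.sqrt ((lam.kSel P + 1 - j : ℕ) : ℝ) * epsOfRecord θ.ν (gOfRecord₁₀ F N θ P) j)
    (hZk : ∀ m, lam.kSel P + 1 - N₀ < m → m < lam.kSel P + 1 → (σ P).Zpp (lam.kSel P + 1) ∩ omegaOfChain (s P) m ⊆ omegaOfChain (s P) (m + 1))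
    (hgeom : ∀ m, D.k₀ < m → m < D.k → ∀ p ∈ plaqsOf (D.Ω m \ D.Ω (m + 1)), 4 * ((m : ℝ) - D.k₀) * D.M ≤ D.dist p)
    (hbox : ∀ p ∈ plaqsOf (half D), D.boxOf p ∈ D.halfcubes ∧ p ∈ D.plaqT (D.boxOf p))
    (L91h : ∀ U, new189 D U → ∀ p ∈ plaqsOf (half D),
      Ineq191 (dist1 (plaqHol (D.Upp U) p)) (D.devV'' U p) D.α ((D.L ^ D.h)⁻¹) (D.ε D.h) (E124 D.ε D.L D.η D.k D.h))
    (L95 : ∀ U, new189 D U → ∀ p ∈ plaqsOf (half D),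
      Ineq195 (D.devV'' U p) (dist1 (plaqHol (D.Uhalf U (D.boxOf p)) p)) D.α ((D.L ^ D.h)⁻¹) (D.ε D.h) (E124 D.ε D.L D.η D.k D.h))
    (L91 : ∀ U, new189 D U → ∀ j, D.h ≤ j → j ≤ D.k → ∀ p ∈ plaqsOf (dom D j),
      Ineq191 (dist1 (plaqHol (D.Upp U) p)) (D.dev97 U p) D.α ((D.L ^ j)⁻¹) (D.ε j) (E124 D.ε D.L D.η D.k j))
    (L97 : ∀ U, new189 D U → ∀ j, D.h ≤ j → j ≤ D.k → ∀ p ∈ plaqsOf (dom D j),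
      Ineq191 (D.dev97 U p) (D.dev0 U p) D.α ((D.L ^ j)⁻¹) (D.ε j) (E124 D.ε D.L D.η D.k j)) :
    B15Leaf (WOfRecord₁₀ F N θ ((lam.pinRPrime θ).pinD189T θ σ s N₀ p₁) P) := by
  subst hD
  exact b15Leaf_WOfRecord₁₀_pinAllχ₀_of_deg_massSel (fun P => ((σ P).pinTerm (s P)).pinNumerics θ.τ9 N₀) p₁ hP hdeg hmassSel hfib hP1 h180
    (h189_pinD189T_of_h180_of_flow N₀ p₁ (lam.pinRPrime θ) σ s P hN2 hNN hNk hβ0 hβ hL₀ hL₀L hB hδ hdist hN₀ hMl hε0 hε1 hβ₀0 hβ₀ hflow hZk hgeom hbox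
      L91h L95 L91 L97 h180)

end Layer

/-! ## §2 STAGE-12 — N12's pointed row and the `NodesAtSomeRecord12` body at the term-pinned layer -/

section Row
variable (θ : Stage12Params F N) (lam : ResidW F N) (σ : ∀ P : B12.RunParams, Sit189 F N P.K)
  (s : ∀ P : B12.RunParams, SeqOfRecord F θ.ν θ.τ9.M (gOfRecord₁₀ F N θ.toStage9Params P) P.K (lam.kSel P + 1)) (N₀ p₁ : ℕ)

/-- **N12's ROW OF THE POINTED INTERFACE AT `θ.pinW (WOfRecord₁₂ θ λ⁵)` WITH NO SEPARATE (1.89) DISPLAY** (dag-n12-d's module 1 §4 `Iff.rfl` + §1's leaf, window form): `B15Leaf ((θ.pinW _).res.W P)`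
at run `P` from the §1 hypotheses at `θ.toStage9Params`. [cite: Balaban1989LargeFieldI, (0.2)–(0.6) p.176, Prop. 1 (1.78) p.194, (1.80) p.195, (1.89) p.198, pp.199–200, (1.99)–(1.102) pp.200–201] -/
theorem b15Leaf_res_W_pinW_WOfRecord₁₂_pinAllT_of_deg_massSel (hP : θ.toStage9Params.Provisos₁₀) {P : B12.RunParams}
    {D : Setting189 (F.P P.K) (SU N) (MSField (F.P P.K) (SU N) × ((j : ℕ) → VecField (F.P P.K) j (EuclideanSpace ℝ (Fin (N ^ 2 - 1))))) (Pt (F.P P.K).d)}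
    (hD : D = ((lam.pinRPrime θ.toStage9Params).pinD189T θ.toStage9Params σ s N₀ p₁).D189 P)
    (hdeg : P.K ≤ lam.kSel P →
      (repDataOfSel (repTOfRecord9 F N θ.ν θ.τ9 (EOfRecord₁₀ F N θ.toStage9Params) (wOfRecord₉ F N θ.toStage9Params) θ.ppSel P
          (gOfRecord₁₀ F N θ.toStage9Params P) (lam.kSel P))
        (θ.ppSel P (gOfRecord₁₀ F N θ.toStage9Params P) (lam.kSel P + 1)) (fibOfSeq F θ.ν θ.τ9 P (gOfRecord₁₀ F N θ.toStage9Params P) (lam.kSel P + 1))).ProvisosSupp)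
    (hmassSel : ∀ t, 0 < ∫ V, rterm (repTOfRecord9 F N θ.ν θ.τ9 (EOfRecord₁₀ F N θ.toStage9Params) (wOfRecord₉ F N θ.toStage9Params) θ.ppSel P
        (gOfRecord₁₀ F N θ.toStage9Params P) (lam.kSel P)) (θ.ppSel P (gOfRecord₁₀ F N θ.toStage9Params P) (lam.kSel P + 1) t) V
          ∂(fieldMeasure (F.P P.K) (lam.kSel P + 1) (SU N)))
    (hfib : ∀ t, ∃ t', θ.ppSel P (gOfRecord₁₀ F N θ.toStage9Params P) (lam.kSel P + 1) t' = θ.ppSel P (gOfRecord₁₀ F N θ.toStage9Params P) (lam.kSel P + 1) t ∧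
      0 < ∫ V, rterm (repTOfRecord9 F N θ.ν θ.τ9 (EOfRecord₁₀ F N θ.toStage9Params) (wOfRecord₉ F N θ.toStage9Params) θ.ppSel P
        (gOfRecord₁₀ F N θ.toStage9Params P) (lam.kSel P)) t' V ∂(fieldMeasure (F.P P.K) (lam.kSel P + 1) (SU N)))
    (hP1 : Prop1Printed (lam.LF P))
    (h180 : ∀ U, new189 D U → ∀ i, D.h ≤ i → i ≤ D.k → ∀ q ∈ plaqsOf (dom D i), Ineq180 (D.dev0 U q) (D.ε D.k) D.η D.B₃ D.B₅ D.M D.δ (D.dist q) D.O1)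
    (hN2 : 2 ≤ N₀) (hNN : N₀ ≤ θ.τ9.Nmem) (hNk : N₀ ≤ lam.kSel P + 1)
    (hβ0 : 0 ≤ (σ P).β) (hβ : (σ P).β ≤ 1 / 4) (hL₀ : 2 ≤ (σ P).L₀) (hL₀L : (σ P).L₀ ^ 2 ≤ ((F.P P.K).L : ℝ))
    (hB : 0 ≤ (σ P).O1 * (σ P).B₃ * (σ P).B₅) (hδ : 0 ≤ (σ P).δ) (hdist : ∀ p, 0 ≤ (σ P).dist p)
    (hN₀ : (2 + (121 / 120) ^ 2 * ((σ P).O1 * (σ P).B₃ * (σ P).B₅ * (θ.τ9.M : ℝ) ^ 5)) * (((σ P).L₀ ^ 2) ^ (N₀ - 1))⁻¹ ≤ 1 / 4)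
    (hMl : (121 / 120) ^ 2 * ((σ P).O1 * (σ P).B₃ * (σ P).B₅ * (θ.τ9.M : ℝ) ^ 5) * Real.exp (-(4 * (σ P).δ * (θ.τ9.M : ℝ))) ≤ 1 / 12)
    (hA₀ : 0 ≤ θ.ν.A₀) {β' β₀ : ℝ} {L : ℕ} (S : SmallnessFor θ.γ β' β₀ L θ.ν.p₀) (hβ₀ : β₀ ≤ 1 / 2) (hε10 : θ.γ * p0Profile θ.ν.A₀ θ.ν.p₀ θ.γ ≤ 1 / 10)
    (hI : Step.InInterval θ.γ (lam.kSel P + 1) (gOfRecord₁₀ F N θ.toStage9Params P)) (hup : BetaUpperH β' θ.γ (betaOfRecord₁₀ F N θ.toStage9Params))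
    (hZk : ∀ m, lam.kSel P + 1 - N₀ < m → m < lam.kSel P + 1 → (σ P).Zpp (lam.kSel P + 1) ∩ omegaOfChain (s P) m ⊆ omegaOfChain (s P) (m + 1))
    (hgeom : ∀ m, D.k₀ < m → m < D.k → ∀ p ∈ plaqsOf (D.Ω m \ D.Ω (m + 1)), 4 * ((m : ℝ) - D.k₀) * D.M ≤ D.dist p)
    (hbox : ∀ p ∈ plaqsOf (half D), D.boxOf p ∈ D.halfcubes ∧ p ∈ D.plaqT (D.boxOf p))
    (L91h : ∀ U, new189 D U → ∀ p ∈ plaqsOf (half D),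
      Ineq191 (dist1 (plaqHol (D.Upp U) p)) (D.devV'' U p) D.α ((D.L ^ D.h)⁻¹) (D.ε D.h) (E124 D.ε D.L D.η D.k D.h))
    (L95 : ∀ U, new189 D U → ∀ p ∈ plaqsOf (half D),
      Ineq195 (D.devV'' U p) (dist1 (plaqHol (D.Uhalf U (D.boxOf p)) p)) D.α ((D.L ^ D.h)⁻¹) (D.ε D.h) (E124 D.ε D.L D.η D.k D.h))
    (L91 : ∀ U, new189 D U → ∀ j, D.h ≤ j → j ≤ D.k → ∀ p ∈ plaqsOf (dom D j),
      Ineq191 (dist1 (plaqHol (D.Upp U) p)) (D.dev97 U p) D.α ((D.L ^ j)⁻¹) (D.ε j) (E124 D.ε D.L D.η D.k j))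
    (L97 : ∀ U, new189 D U → ∀ j, D.h ≤ j → j ≤ D.k → ∀ p ∈ plaqsOf (dom D j),
      Ineq191 (D.dev97 U p) (D.dev0 U p) D.α ((D.L ^ j)⁻¹) (D.ε j) (E124 D.ε D.L D.η D.k j)) :
    B15Leaf ((θ.pinW F N (WOfRecord₁₂ F N θ ((lam.pinRPrime θ.toStage9Params).pinD189T θ.toStage9Params σ s N₀ p₁))).res.W P) :=
  b15Leaf_WOfRecord₁₀_pinAllT_of_deg_massSel σ s N₀ p₁ hP hD hdeg hmassSel hfib hP1 h180 hN2 hNN hNk hβ0 hβ hL₀ hL₀L hB hδ hdist hN₀ hMl hA₀ S hβ₀ hε10 hI hup hZk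
    hgeom hbox L91h L95 L91 L97

variable (hP : θ.Provisos₁₂ F N)

/-- **THE BODY OF `NodesAtSomeRecord12` WITH N12 READ AT THE TERM-PINNED BUNDLE OF RECORD** — dag-n12-d's `nodesAtSomeRecord₁₂_of_pointed_pinW` at `W₀ := WOfRecord₁₂ θ λ⁵`, the N12 row
`h12T` = the §1 leaf RUN BY RUN (`b15Leaf_WOfRecord₁₀_pinAllT_of_deg_massSel` ∕ `…_of_flow` produce it from `hdeg`, `hmassSel ∧ hfib`, Prop. 1, (1.80) and the (1.89) residue — NO (1.89)
display); every other row is module 27's at `θ`.  COMPOSITE; NOT a discharge of N12; count-neutral. [cite: Balaban1989LargeFieldI, (0.2)–(0.6) p.176, Prop. 1 (1.78) p.194, (1.80) p.195, (1.89) p.198; Balaban1989LargeFieldII, Thm 1 p.355 + p.391 (bookkeeping: the stub's body)] -/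
theorem nodesAtSomeRecord₁₂_of_pointed_pinW_WOfRecord₁₂_pinAllT (hθ : θ.Admissible F N) (hU : θ.ZtUnity F N ∧ θ.SlotsNondegenerate) (w : WorldP)
    (hC : w.C = (datumOfRecord₁₂ F N θ hP).C) (hγ : 0 < w.γ ∧ w.γ ≤ θ.γ) (hL : w.L = (θ.L : ℝ))
    (hup : ∀ P, w.up P = upOfRecord₅C F N
      ((θ.pinW F N (WOfRecord₁₂ F N θ ((lam.pinRPrime θ.toStage9Params).pinD189T θ.toStage9Params σ s N₀ p₁))).toStage5₁₂ F N) P)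
    (h05 : ∀ P : B12.RunParams,
      B8LeafR (θ.res.X P).d8 (θ.res.X P).L8 (θ.res.X P).C₂ (θ.res.X P).B₁' (θ.res.X P).B₀' (θ.res.X P).B₁ (θ.res.X P).B₂ (θ.res.X P).c₁
        (θ.res.X P).inp8 (θ.res.X P).B₀β (θ.res.X P).loc8 (θ.res.X P).fam8R (θ.res.X P).lan8 (θ.res.X P).cub8 (θ.res.X P).toAxial8)
    (h06 : ∀ P : B12.RunParams, B9LeafX (θ.res.Y P))
    (h07 : ∀ P : B12.RunParams, B11Leaf (θ.res.Z P))
    (h08 : ∀ P : B12.RunParams, ∃ (Xc : PrintedCarriersR) (I : Type) (C : B10Assembly.Consts) (T : I → B10.TowerRun),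
      Nonempty (∀ i, B10Assembly.LeafSystem C (T i)) ∧ θ.res.X P = Xc.withTowerRuns10 T)
    (h09 : ∀ P : B12.RunParams, B12Sec2to5.Lemma4Printed (θ.res.X P).F12 (θ.res.X P).c12)
    (h09T : ∀ P : B12.RunParams, (leavesP w P).smallCouplings → (leavesP w P).smallFieldInductive)
    (h10 : ∀ P : B12.RunParams, B9LeafX (θ.res.Y P) →
      (B10.Thm1PrintedCompact (θ.res.X P).runs10 ∧ B10.Thm2Printed (θ.res.X P).runs10) →
        B11Leaf (θ.res.Z P) → B12Sec2to5.Lemma4Printed (θ.res.X P).F12 (θ.res.X P).c12 →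
          B13.Lemma1Printed (θ.res.X P).S13 (θ.res.X P).c13 ∧ B13.Lemma2Printed (θ.res.X P).S13 (θ.res.X P).c13 ∧
            B13.Lemma3Printed (θ.res.X P).S13 (θ.res.X P).c13)
    (h11 : ∀ P : B12.RunParams, (leavesP w P).b7 → (leavesP w P).b8 → (leavesP w P).b9 → (leavesP w P).b10 → (leavesP w P).b11 →
      (leavesP w P).smallCouplings → (leavesP w P).smallFieldInductive → (leavesP w P).flowControl →
        ∀ k, k < P.K → SLaw₁₂ F N θ P k → TLaw₁₂ F N θ P k)
    (h12T : ∀ P : B12.RunParams, B15Leaf (WOfRecord₁₀ F N θ.toStage9Params ((lam.pinRPrime θ.toStage9Params).pinD189T θ.toStage9Params σ s N₀ p₁) P))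
    (hR : ∀ (P : B12.RunParams) (k : ℕ), k < P.K → TLaw₁₂ F N θ P k → SLaw₁₂ F N θ P (k + 1))
    (hcor3 : ∃ R : B14Cor3.ReprFamily (datumOfRecord₁₂ F N θ hP).C,
      B14Cor3.LeafH (datumOfRecord₁₂ F N θ hP).C R w.γ ∧ B14Cor3.LeafU1 (datumOfRecord₁₂ F N θ hP).C R w.γ ∧
        B14Cor3.LeafU2 (datumOfRecord₁₂ F N θ hP).C R w.γ w.ep ∧ B14Cor3.LeafL1 (datumOfRecord₁₂ F N θ hP).C R w.γ ∧
          B14Cor3.LeafL2 (datumOfRecord₁₂ F N θ hP).C R w.γ w.em) :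
    ∃ (θ' : Stage12Params F N) (h' : θ'.Provisos₁₂ F N) (w' : WorldP), (θ'.ZtUnity F N ∧ θ'.SlotsNondegenerate) ∧ θ'.Admissible F N ∧
      IsRecordOfRecord₁₂C F N (datumOfRecord₁₂ F N θ' h') w' ∧ ∀ P : B12.RunParams, Nodes (leavesP w' P) :=
  nodesAtSomeRecord₁₂_of_pointed_pinW θ hP hθ hU _ w hC hγ hL hup h05 h06 h07 h08 h09 h09T h10 h11 h12T hR hcor3

end Row

/-! ## §3 ON THE K0′ WITNESS LINE `θ₀ˡⁱᵛᵉ := theta12LiveOfRecord F N ζ Rz Zt` (`γ = 1/2`, `A₁ = 1`, `τ9.M = 1`, K0a `rfl`) -/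

section Theta
variable (ζ : ZetaOfRecord F N numerics7OfRecord₁₂ 1) (Rz : (K : ℕ) → Sect2.Residual (F.P K) (MatA N)) (Zt : (K : ℕ) → TkResidualW F N (FluctV N) K)

/-- **CENSUS (typing strength, count-neutral): ON THE WITNESS LINE THE WINDOW ROUTE TO (1.89)'s FLOW INPUTS IS CLOSED** — `θ₀ˡⁱᵛᵉ.γ = 1/2` (K0a) and [III] (2.7)'s smallness `SmallnessFor γ …`
is unsatisfiable at `γ ≥ 1/2` (module 11's `not_smallnessFor_of_half_le`: `4p₀ + 2 ≤ log γ⁻² ≤ log 4 < 2` is false).  So module 5's discharge of `hε0 ∕ hε1 ∕ hflow` from the run's window and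
§1's window form are unavailable at `θ₀ˡⁱᵛᵉ`; there the flow inputs stay DISPLAYED (window-free forms).  A witness with `log γ⁻² ≥ 4p₀ + 2` would re-enable them — a K0′-line design input,
not a gap. [cite: Balaban1988Convergent, (2.7) p.255; Balaban1987RG1, Thm 1 p.255 (the window `]0, γ]`)] -/
theorem not_smallnessFor_theta12Live {β' β₀ : ℝ} {L p : ℕ} : ¬ SmallnessFor (theta12LiveOfRecord F N ζ Rz Zt).γ β' β₀ L p :=
  not_smallnessFor_of_half_le (by rw [theta12LiveOfRecord_γ])

end Theta

/-! ## §4 (v1.2) `N₀` OF RECORD — the layer `λᴺ := (λ.pinRPrime θ₉).pinD189N θ₉ σ s p₁` (module 12: `N₀ := N0OfRecord θ P (kSel P + 1)` per run) -/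

section N0
variable {θ : Stage9Params F N} {lam : ResidW F N} (σ : ∀ P : B12.RunParams, Sit189 F N P.K)
  (s : ∀ P : B12.RunParams, SeqOfRecord F θ.ν θ.τ9.M (gOfRecord₁₀ F N θ P) P.K (lam.kSel P + 1)) (p₁ : ℕ)

/-- At run `P` the `N₀`-pinned layer's [IV] bundle of record IS the term-pinned one read at `N₀ := N0OfRecord θ P (kSel P + 1)` (`rfl`: `WOfRecord₁₀` reads `λ` through
`kSel P`, `LF P`, `D189 P`, `D1100 P` only). [cite: Balaban1989LargeFieldI, (0.2) p.176, (1.89) p.198, p.200 (bookkeeping)] -/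
theorem WOfRecord₁₀_pinAllN (P : B12.RunParams) : WOfRecord₁₀ F N θ ((lam.pinRPrime θ).pinD189N θ σ s p₁) P =
    WOfRecord₁₀ F N θ ((lam.pinRPrime θ).pinD189T θ σ s (N0OfRecord θ P (lam.kSel P + 1)) p₁) P := rfl

/-- **THE [IV] LEAF AT `WOfRecord₁₀ θ λᴺ P` WITH NO (1.89) DISPLAY, NO `N₀` PARAMETER AND PRINT'S FIRST p. 200 CONDITION DISCHARGED** — §1's leaf at `N₀ := N0OfRecord θ P (kSel P + 1)`
with `2 ≤ N₀` and `hN₀` supplied by module 12 (`two_le_N0OfRecord ∘ one_lt_log_pow_of_inInterval`, `printCond1_N0OfRecord_of_threshold`): displayed instead `r ≥ 1`, `β ≥ 0` along the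
history below `kSel P + 1`, ONE threshold `4(2 + (121/120)²O(1)B₃B₅M⁵) ≤ ((log g_{kSel P+1}⁻²)^r)^{(log L₀²)/(log L)}` (*"or γ sufficiently small"*); window form. Letters via
`hD : D = λᴺ.D189 P` (`rfl`). [cite: Balaban1989LargeFieldI, (0.2)–(0.6) p.176, Prop. 1 (1.78) p.194, (1.80) p.195, (1.89) p.198, pp.199–200; Balaban1988Convergent, (2.1) p.254, (2.5)–(2.8) pp.255–256] -/
theorem b15Leaf_WOfRecord₁₀_pinAllN_of_deg_massSel (hP : θ.Provisos₁₀) {P : B12.RunParams}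
    {D : Setting189 (F.P P.K) (SU N) (MSField (F.P P.K) (SU N) × ((j : ℕ) → VecField (F.P P.K) j (EuclideanSpace ℝ (Fin (N ^ 2 - 1))))) (Pt (F.P P.K).d)}
    (hD : D = ((lam.pinRPrime θ).pinD189N θ σ s p₁).D189 P)
    (hdeg : P.K ≤ lam.kSel P →
      (repDataOfSel (repTOfRecord9 F N θ.ν θ.τ9 (EOfRecord₁₀ F N θ) (wOfRecord₉ F N θ) θ.ppSel P (gOfRecord₁₀ F N θ P) (lam.kSel P))
        (θ.ppSel P (gOfRecord₁₀ F N θ P) (lam.kSel P + 1)) (fibOfSeq F θ.ν θ.τ9 P (gOfRecord₁₀ F N θ P) (lam.kSel P + 1))).ProvisosSupp)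
    (hmassSel : ∀ t, 0 < ∫ V, rterm (repTOfRecord9 F N θ.ν θ.τ9 (EOfRecord₁₀ F N θ) (wOfRecord₉ F N θ) θ.ppSel P (gOfRecord₁₀ F N θ P) (lam.kSel P))
      (θ.ppSel P (gOfRecord₁₀ F N θ P) (lam.kSel P + 1) t) V ∂(fieldMeasure (F.P P.K) (lam.kSel P + 1) (SU N)))
    (hfib : ∀ t, ∃ t', θ.ppSel P (gOfRecord₁₀ F N θ P) (lam.kSel P + 1) t' = θ.ppSel P (gOfRecord₁₀ F N θ P) (lam.kSel P + 1) t ∧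
      0 < ∫ V, rterm (repTOfRecord9 F N θ.ν θ.τ9 (EOfRecord₁₀ F N θ) (wOfRecord₉ F N θ) θ.ppSel P (gOfRecord₁₀ F N θ P) (lam.kSel P)) t' V
        ∂(fieldMeasure (F.P P.K) (lam.kSel P + 1) (SU N)))
    (hP1 : Prop1Printed (lam.LF P))
    (h180 : ∀ U, new189 D U → ∀ i, D.h ≤ i → i ≤ D.k → ∀ q ∈ plaqsOf (dom D i), Ineq180 (D.dev0 U q) (D.ε D.k) D.η D.B₃ D.B₅ D.M D.δ (D.dist q) D.O1)
    -- the (1.89) residue with N₀ of record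
    (hr : 1 ≤ θ.ν.r) (hNN : N0OfRecord θ P (lam.kSel P + 1) ≤ θ.τ9.Nmem) (hNk : N0OfRecord θ P (lam.kSel P + 1) ≤ lam.kSel P + 1)
    (hβ0 : 0 ≤ (σ P).β) (hβ : (σ P).β ≤ 1 / 4) (hL₀ : 2 ≤ (σ P).L₀) (hL₀L : (σ P).L₀ ^ 2 ≤ ((F.P P.K).L : ℝ))
    (hB : 0 ≤ (σ P).O1 * (σ P).B₃ * (σ P).B₅) (hδ : 0 ≤ (σ P).δ) (hdist : ∀ p, 0 ≤ (σ P).dist p)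
    (hwin : 4 * (2 + (121 / 120) ^ 2 * ((σ P).O1 * (σ P).B₃ * (σ P).B₅ * (θ.τ9.M : ℝ) ^ 5))
      ≤ ((Real.log (gOfRecord₁₀ F N θ P (lam.kSel P + 1) ^ 2)⁻¹) ^ θ.ν.r) ^ (Real.log ((σ P).L₀ ^ 2) / Real.log ((F.P P.K).L : ℝ)))
    (hβhist : ∀ j, j < lam.kSel P + 1 → 0 ≤ betaOfRecord₁₀ F N θ j (prefixOf (gOfRecord₁₀ F N θ P) j))
    (hMl : (121 / 120) ^ 2 * ((σ P).O1 * (σ P).B₃ * (σ P).B₅ * (θ.τ9.M : ℝ) ^ 5) * Real.exp (-(4 * (σ P).δ * (θ.τ9.M : ℝ))) ≤ 1 / 12)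
    (hA₀ : 0 ≤ θ.ν.A₀) {β' β₀ : ℝ} {L : ℕ} (S : SmallnessFor θ.γ β' β₀ L θ.ν.p₀) (hβ₀ : β₀ ≤ 1 / 2) (hε10 : θ.γ * p0Profile θ.ν.A₀ θ.ν.p₀ θ.γ ≤ 1 / 10)
    (hI : Step.InInterval θ.γ (lam.kSel P + 1) (gOfRecord₁₀ F N θ P)) (hup : BetaUpperH β' θ.γ (betaOfRecord₁₀ F N θ))
    (hZk : ∀ m, lam.kSel P + 1 - N0OfRecord θ P (lam.kSel P + 1) < m → m < lam.kSel P + 1 →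
      (σ P).Zpp (lam.kSel P + 1) ∩ omegaOfChain (s P) m ⊆ omegaOfChain (s P) (m + 1))
    (hgeom : ∀ m, D.k₀ < m → m < D.k → ∀ p ∈ plaqsOf (D.Ω m \ D.Ω (m + 1)), 4 * ((m : ℝ) - D.k₀) * D.M ≤ D.dist p)
    (hbox : ∀ p ∈ plaqsOf (half D), D.boxOf p ∈ D.halfcubes ∧ p ∈ D.plaqT (D.boxOf p))
    (L91h : ∀ U, new189 D U → ∀ p ∈ plaqsOf (half D),
      Ineq191 (dist1 (plaqHol (D.Upp U) p)) (D.devV'' U p) D.α ((D.L ^ D.h)⁻¹) (D.ε D.h) (E124 D.ε D.L D.η D.k D.h))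
    (L95 : ∀ U, new189 D U → ∀ p ∈ plaqsOf (half D),
      Ineq195 (D.devV'' U p) (dist1 (plaqHol (D.Uhalf U (D.boxOf p)) p)) D.α ((D.L ^ D.h)⁻¹) (D.ε D.h) (E124 D.ε D.L D.η D.k D.h))
    (L91 : ∀ U, new189 D U → ∀ j, D.h ≤ j → j ≤ D.k → ∀ p ∈ plaqsOf (dom D j),
      Ineq191 (dist1 (plaqHol (D.Upp U) p)) (D.dev97 U p) D.α ((D.L ^ j)⁻¹) (D.ε j) (E124 D.ε D.L D.η D.k j))
    (L97 : ∀ U, new189 D U → ∀ j, D.h ≤ j → j ≤ D.k → ∀ p ∈ plaqsOf (dom D j),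
      Ineq191 (D.dev97 U p) (D.dev0 U p) D.α ((D.L ^ j)⁻¹) (D.ε j) (E124 D.ε D.L D.η D.k j)) :
    B15Leaf (WOfRecord₁₀ F N θ ((lam.pinRPrime θ).pinD189N θ σ s p₁) P) := by
  subst hD
  exact b15Leaf_WOfRecord₁₀_pinAllχ₀_of_deg_massSel (fun P => ((σ P).pinTerm (s P)).pinNumerics θ.τ9 (N0OfRecord θ P (lam.kSel P + 1))) p₁ hP hdeg
    hmassSel hfib hP1 h180
    (h189_pinD189N_of_h180 (lam.pinRPrime θ) σ s p₁ P rfl hr hNN hNk hβ0 hβ hL₀ hL₀L hB hδ hdist hwin hβhist hMl hA₀ S hβ₀ hε10 hI hup hZk hgeom hbox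
      L91h L95 L91 L97 h180)

/-- **THE SAME LEAF, WINDOW-FREE FORM WITH `N₀` OF RECORD** (flow inputs displayed; the history in `]0, γ]`, `γ ≤ 1`, and `1 < (log g⁻²)^r` at the top coupling feed `N₀`).
[cite: Balaban1989LargeFieldI, (0.2)–(0.6) p.176, Prop. 1 (1.78) p.194, (1.80) p.195, (1.89) p.198, pp.199–200; Balaban1988Convergent, (2.5)–(2.8) pp.255–256] -/
theorem b15Leaf_WOfRecord₁₀_pinAllN_of_deg_massSel_of_flow (hP : θ.Provisos₁₀) {P : B12.RunParams}
    {D : Setting189 (F.P P.K) (SU N) (MSField (F.P P.K) (SU N) × ((j : ℕ) → VecField (F.P P.K) j (EuclideanSpace ℝ (Fin (N ^ 2 - 1))))) (Pt (F.P P.K).d)}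
    (hD : D = ((lam.pinRPrime θ).pinD189N θ σ s p₁).D189 P)
    (hdeg : P.K ≤ lam.kSel P →
      (repDataOfSel (repTOfRecord9 F N θ.ν θ.τ9 (EOfRecord₁₀ F N θ) (wOfRecord₉ F N θ) θ.ppSel P (gOfRecord₁₀ F N θ P) (lam.kSel P))
        (θ.ppSel P (gOfRecord₁₀ F N θ P) (lam.kSel P + 1)) (fibOfSeq F θ.ν θ.τ9 P (gOfRecord₁₀ F N θ P) (lam.kSel P + 1))).ProvisosSupp)
    (hmassSel : ∀ t, 0 < ∫ V, rterm (repTOfRecord9 F N θ.ν θ.τ9 (EOfRecord₁₀ F N θ) (wOfRecord₉ F N θ) θ.ppSel P (gOfRecord₁₀ F N θ P) (lam.kSel P))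
      (θ.ppSel P (gOfRecord₁₀ F N θ P) (lam.kSel P + 1) t) V ∂(fieldMeasure (F.P P.K) (lam.kSel P + 1) (SU N)))
    (hfib : ∀ t, ∃ t', θ.ppSel P (gOfRecord₁₀ F N θ P) (lam.kSel P + 1) t' = θ.ppSel P (gOfRecord₁₀ F N θ P) (lam.kSel P + 1) t ∧
      0 < ∫ V, rterm (repTOfRecord9 F N θ.ν θ.τ9 (EOfRecord₁₀ F N θ) (wOfRecord₉ F N θ) θ.ppSel P (gOfRecord₁₀ F N θ P) (lam.kSel P)) t' V
        ∂(fieldMeasure (F.P P.K) (lam.kSel P + 1) (SU N)))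
    (hP1 : Prop1Printed (lam.LF P))
    (h180 : ∀ U, new189 D U → ∀ i, D.h ≤ i → i ≤ D.k → ∀ q ∈ plaqsOf (dom D i), Ineq180 (D.dev0 U q) (D.ε D.k) D.η D.B₃ D.B₅ D.M D.δ (D.dist q) D.O1)
    (hg1 : 1 < (Real.log (gOfRecord₁₀ F N θ P (lam.kSel P + 1) ^ 2)⁻¹) ^ θ.ν.r)
    (hNN : N0OfRecord θ P (lam.kSel P + 1) ≤ θ.τ9.Nmem) (hNk : N0OfRecord θ P (lam.kSel P + 1) ≤ lam.kSel P + 1)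
    (hβ0 : 0 ≤ (σ P).β) (hβ : (σ P).β ≤ 1 / 4) (hL₀ : 2 ≤ (σ P).L₀) (hL₀L : (σ P).L₀ ^ 2 ≤ ((F.P P.K).L : ℝ))
    (hB : 0 ≤ (σ P).O1 * (σ P).B₃ * (σ P).B₅) (hδ : 0 ≤ (σ P).δ) (hdist : ∀ p, 0 ≤ (σ P).dist p)
    (hwin : 4 * (2 + (121 / 120) ^ 2 * ((σ P).O1 * (σ P).B₃ * (σ P).B₅ * (θ.τ9.M : ℝ) ^ 5))
      ≤ ((Real.log (gOfRecord₁₀ F N θ P (lam.kSel P + 1) ^ 2)⁻¹) ^ θ.ν.r) ^ (Real.log ((σ P).L₀ ^ 2) / Real.log ((F.P P.K).L : ℝ)))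
    {γ : ℝ} (hγ1 : γ ≤ 1) (hIγ : Step.InInterval γ (lam.kSel P + 1) (gOfRecord₁₀ F N θ P))
    (hβhist : ∀ j, j < lam.kSel P + 1 → 0 ≤ betaOfRecord₁₀ F N θ j (prefixOf (gOfRecord₁₀ F N θ P) j))
    (hMl : (121 / 120) ^ 2 * ((σ P).O1 * (σ P).B₃ * (σ P).B₅ * (θ.τ9.M : ℝ) ^ 5) * Real.exp (-(4 * (σ P).δ * (θ.τ9.M : ℝ))) ≤ 1 / 12)
    (hε0 : ∀ i, lam.kSel P + 1 - θ.τ9.Nmem ≤ i → i ≤ lam.kSel P + 1 → 0 ≤ epsOfRecord θ.ν (gOfRecord₁₀ F N θ P) i)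
    (hε1 : ∀ i, lam.kSel P + 1 - θ.τ9.Nmem ≤ i → i ≤ lam.kSel P + 1 → epsOfRecord θ.ν (gOfRecord₁₀ F N θ P) i ≤ 1 / 10)
    {β₀ : ℝ} (hβ₀0 : 0 ≤ β₀) (hβ₀ : β₀ ≤ 1 / 2)
    (hflow : ∀ j, lam.kSel P + 1 - θ.τ9.Nmem ≤ j → j < lam.kSel P + 1 →
      epsOfRecord θ.ν (gOfRecord₁₀ F N θ P) (lam.kSel P + 1) ≤ (1 + β₀) * Real.sqrt ((lam.kSel P + 1 - j : ℕ) : ℝ) * epsOfRecord θ.ν (gOfRecord₁₀ F N θ P) j)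
    (hZk : ∀ m, lam.kSel P + 1 - N0OfRecord θ P (lam.kSel P + 1) < m → m < lam.kSel P + 1 →
      (σ P).Zpp (lam.kSel P + 1) ∩ omegaOfChain (s P) m ⊆ omegaOfChain (s P) (m + 1))
    (hgeom : ∀ m, D.k₀ < m → m < D.k → ∀ p ∈ plaqsOf (D.Ω m \ D.Ω (m + 1)), 4 * ((m : ℝ) - D.k₀) * D.M ≤ D.dist p)
    (hbox : ∀ p ∈ plaqsOf (half D), D.boxOf p ∈ D.halfcubes ∧ p ∈ D.plaqT (D.boxOf p))
    (L91h : ∀ U, new189 D U → ∀ p ∈ plaqsOf (half D),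
      Ineq191 (dist1 (plaqHol (D.Upp U) p)) (D.devV'' U p) D.α ((D.L ^ D.h)⁻¹) (D.ε D.h) (E124 D.ε D.L D.η D.k D.h))
    (L95 : ∀ U, new189 D U → ∀ p ∈ plaqsOf (half D),
      Ineq195 (D.devV'' U p) (dist1 (plaqHol (D.Uhalf U (D.boxOf p)) p)) D.α ((D.L ^ D.h)⁻¹) (D.ε D.h) (E124 D.ε D.L D.η D.k D.h))
    (L91 : ∀ U, new189 D U → ∀ j, D.h ≤ j → j ≤ D.k → ∀ p ∈ plaqsOf (dom D j),
      Ineq191 (dist1 (plaqHol (D.Upp U) p)) (D.dev97 U p) D.α ((D.L ^ j)⁻¹) (D.ε j) (E124 D.ε D.L D.η D.k j))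
    (L97 : ∀ U, new189 D U → ∀ j, D.h ≤ j → j ≤ D.k → ∀ p ∈ plaqsOf (dom D j),
      Ineq191 (D.dev97 U p) (D.dev0 U p) D.α ((D.L ^ j)⁻¹) (D.ε j) (E124 D.ε D.L D.η D.k j)) :
    B15Leaf (WOfRecord₁₀ F N θ ((lam.pinRPrime θ).pinD189N θ σ s p₁) P) := by
  subst hD
  exact b15Leaf_WOfRecord₁₀_pinAllχ₀_of_deg_massSel (fun P => ((σ P).pinTerm (s P)).pinNumerics θ.τ9 (N0OfRecord θ P (lam.kSel P + 1))) p₁ hP hdeg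
    hmassSel hfib hP1 h180
    (h189_pinD189N_of_h180_of_flow (lam.pinRPrime θ) σ s p₁ P rfl hg1 hNN hNk hβ0 hβ hL₀ hL₀L hB hδ hdist hwin hγ1 hIγ hβhist hMl hε0 hε1 hβ₀0 hβ₀ hflow hZk
      hgeom hbox L91h L95 L91 L97 h180)

end N0

end Summit.QuantumFields.YangMills.BalabanUVNodes.N12AtRecord12TermPin

end
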